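import Mathlib
import HarnessLib
import Summits.AtomisticToContinuum.Crystallization.Theses.OverbindingBudget

/-!
# OverbindingBudget — the `Assembly` item (stmt-30880)

The route's assembly statement `RedMu → A → S → P1 → D⁺ → D⁻ → R → LAW → FLAT → FATX → THIN → Crystallization` has
exactly the binders of the gate-certified deciding theorem `Theses.OverbindingBudget.closes` (rev 3, 11 binders), so it
is that theorem, curried.
-/

namespace Summit.AtomisticToContinuum.Crystallization.Theorems.OverbindingBudgetAssembly

/-- The assembly item of route `OverbindingBudget` is its deciding theorem `closes`. [this file] -/
theorem assembly : Summit.AtomisticToContinuum.Crystallization.Theses.OverbindingBudget.Assembly :=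
  fun h₁ h₂ h₃ h₄ h₅ h₆ h₇ h₈ h₉ h₁₀ h₁₁ =>
    Summit.AtomisticToContinuum.Crystallization.Theses.OverbindingBudget.closes h₁ h₂ h₃ h₄ h₅ h₆ h₇ h₈ h₉ h₁₀ h₁₁

end Summit.AtomisticToContinuum.Crystallization.Theorems.OverbindingBudgetAssembly
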